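import Literature.AnabelianGeometry.SemiGraphs.TemperedReconstructionCor39UpToTwistProofs
import Literature.AnabelianGeometry.SemiGraphs.TemperedReconstructionCor39UpToTwistAssemblyAt
import HarnessLib

/-!
# Corollary 3.9 up to twist (named twin `Cor39CompatUpToTwist`) — AT ONE PAIR OF GRAPHS (φ2 twin)

Mochizuki, *Semi-graphs of anabelioids*, Publ. RIMS **42** (2006), §3, Cor. 3.9, proof pp. 42–43
[cite: MochizukiSemiAnbd2006, Cor 3.9 pp.42-43].

Companion of `TemperedReconstructionCor39UpToTwistProofs.lean` (abc-iut-w4-d080) under the cell's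
φ2-consumers programme (rulings φ2 / α4-3 / α5-3 / α6 of abc-iut-L3-lead): the discharge of the named
twin `Cor39CompatUpToTwist` is re-done AT ONE PAIR `(𝒢, ℋ)` with charts `(c𝒢, cℋ)` — its BODY at the
pair (the ∀-statement has no per-pair name) — with Thm. 3.7 (iii) entering AT `ℋ` only through (R3)
(abc-iut-w4-d064's `chartPullbackWith_iso_of_compatibleAt`), the per-pair (R0′)/(R2′) left as inline
binders for abc-iut-w4-d083's per-pair theorems, and (b)-uniqueness unconditional
(`base_eq_of_inducesUpToTwist`); then THE PER-PAIR CLOSER OF RECORD `cor39CompatUpToTwistAt (h𝒢iii :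
CompactInVerticialAt 𝒢) (hℋiii : CompactInVerticialAt ℋ)` (ruling α6-1) binding those two to
abc-iut-w4-d083's `isCompatiblyQuasiGeometric_of_compatAt` / `quasiGeometricGraphDataCompatAt_of_compactInVerticialAt`
(Thm. 3.7 (iv) at a graph via abc-iut-w4-d075's `maximalCompactIffVerticialAt_of_compactInVerticialAt`),
and the sanity link `cor39CompatUpToTwist_of_forall_compactInVerticialAt'` back to the ∀-countable
named twin.  Both inputs are delivered for finite `𝔾` by the finite-`𝔾` producer
(`compactInVerticialAt_of_finiteLevelData`).  Proof-only; the original file is untouched; nothing here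
asserts Thm. 3.7 (iii) for an infinite `𝔾`.  Nothing here takes a side on [IUTchIII] Cor. 3.12;
typed ≠ discharged.
-/

open CategoryTheory

namespace Literature.AnabelianGeometry.SemiGraphs

namespace ProfiniteSemiGraph

universe u

variable {𝒢 ℋ : ProfiniteSemiGraph.{u}}

namespace Hom

/-- (R3, up to twist, Thm. 3.7 (iii) AT `ℋ`) "compatible up to conjugation with a locally open `F`"
⇒ "induced by `F` up to twist" — per-graph form of `Hom.inducesUpToTwist_of_compat`.
[cite: MochizukiSemiAnbd2006, Cor 3.9 p.43] -/
theorem inducesUpToTwist_of_compatAt (hℋiii : CompactInVerticialAt ℋ) (h𝒢 : Cor39Hypotheses 𝒢)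
    (hℋ : Cor39Hypotheses ℋ) (c𝒢 : TemperedPiChart 𝒢) (cℋ : TemperedPiChart ℋ) (F : Hom 𝒢 ℋ)
    (φ : c𝒢.G →ₜ* cℋ.G) (hF : F.IsLocallyOpen) (hV : F.CompatV c𝒢 cℋ φ) (hE : F.CompatE c𝒢 cℋ φ) :
    F.InducesUpToTwist c𝒢 cℋ φ :=
  chartPullbackWith_iso_of_compatibleAt hℋiii h𝒢 hℋ c𝒢 cℋ F φ hF hV hE

/-- For a locally open `F` (Thm. 3.7 (iii) AT `ℋ`): "induced by `F` up to twist" ⟺ "compatible up to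
conjugation with `F`" — per-graph form of `Hom.inducesUpToTwist_iff_compat`.
[cite: MochizukiSemiAnbd2006, Cor 3.9 p.43] -/
theorem inducesUpToTwist_iff_compatAt (hℋiii : CompactInVerticialAt ℋ) (h𝒢 : Cor39Hypotheses 𝒢)
    (hℋ : Cor39Hypotheses ℋ) (c𝒢 : TemperedPiChart 𝒢) (cℋ : TemperedPiChart ℋ) (F : Hom 𝒢 ℋ)
    (φ : c𝒢.G →ₜ* cℋ.G) (hF : F.IsLocallyOpen) :
    F.InducesUpToTwist c𝒢 cℋ φ ↔ F.CompatV c𝒢 cℋ φ ∧ F.CompatE c𝒢 cℋ φ :=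
  ⟨F.compat_of_inducesUpToTwist c𝒢 cℋ φ,
    fun h => inducesUpToTwist_of_compatAt hℋiii h𝒢 hℋ c𝒢 cℋ F φ hF h.1 h.2⟩

end Hom

/-- **`Cor39CompatUpToTwist` at the pair `(G, H)` from the per-pair (R0′), (R2′) and Thm. 3.7 (iii)
AT `ℋ`** — the body of the named twin at the pair: (a) = R1 ≫ R0′; (b)-existence = R2′ ≫ R3 (AT `ℋ`);
(b)-uniqueness of the whole underlying morphism of semi-graphs, unconditional.
[cite: MochizukiSemiAnbd2006, Cor 3.9 pp.42-43] -/
theorem cor39CompatUpToTwist_of_R0_R2At (hℋiii : CompactInVerticialAt ℋ) (h𝒢 : Cor39Hypotheses 𝒢)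
    (hℋ : Cor39Hypotheses ℋ) (c𝒢 : TemperedPiChart 𝒢) (cℋ : TemperedPiChart ℋ)
    (hR0 : ∀ (F : Hom 𝒢 ℋ) (φ : c𝒢.G →ₜ* cℋ.G), F.IsLocallyOpen → F.CompatV c𝒢 cℋ φ →
      F.CompatE c𝒢 cℋ φ → IsCompatiblyQuasiGeometric φ)
    (hR2 : ∀ φ : c𝒢.G →ₜ* cℋ.G, IsCompatiblyQuasiGeometric φ →
      ∃ F : Hom 𝒢 ℋ, F.IsLocallyOpen ∧ F.CompatV c𝒢 cℋ φ ∧ F.CompatE c𝒢 cℋ φ) :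
    (∀ (F : Hom 𝒢 ℋ), F.IsLocallyOpen → ∀ φ : c𝒢.G →ₜ* cℋ.G, F.InducesUpToTwist c𝒢 cℋ φ →
        IsCompatiblyQuasiGeometric φ) ∧
      ∀ φ : c𝒢.G →ₜ* cℋ.G, IsCompatiblyQuasiGeometric φ →
        ∃ F : Hom 𝒢 ℋ, F.IsLocallyOpen ∧ F.InducesUpToTwist c𝒢 cℋ φ ∧
          ∀ F' : Hom 𝒢 ℋ, F'.IsLocallyOpen → F'.InducesUpToTwist c𝒢 cℋ φ → F'.base = F.base := by
  refine ⟨fun F hF φ hind => ?_, fun φ hφ => ?_⟩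
  · obtain ⟨hV, hE⟩ := F.compat_of_inducesUpToTwist c𝒢 cℋ φ hind
    exact hR0 F φ hF hV hE
  · obtain ⟨F, hF, hV, hE⟩ := hR2 φ hφ
    exact ⟨F, hF, Hom.inducesUpToTwist_of_compatAt hℋiii h𝒢 hℋ c𝒢 cℋ F φ hF hV hE,
      fun F' hF' hind' => (base_eq_of_inducesUpToTwist h𝒢 hℋ c𝒢 cℋ hF hF'
        (Hom.inducesUpToTwist_of_compatAt hℋiii h𝒢 hℋ c𝒢 cℋ F φ hF hV hE) hind').symm⟩

/-- The ∀-countable discharge specialises: `Cor39CompatUpToTwist` from `CompactInVerticialAt` at every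
graph and the ∀-forms of (R0′)/(R2′) over the compatible reading (sanity link to
`cor39CompatUpToTwist_of_compactInVerticial`). [cite: MochizukiSemiAnbd2006, Cor 3.9 pp.42-43] -/
theorem cor39CompatUpToTwist_of_forall_compactInVerticialAt
    (hiii : ∀ 𝒢 : ProfiniteSemiGraph.{u}, CompactInVerticialAt 𝒢)
    (hR0 : ∀ (𝒢 ℋ : ProfiniteSemiGraph.{u}), Cor39Hypotheses 𝒢 → Cor39Hypotheses ℋ →
      ∀ (c𝒢 : TemperedPiChart 𝒢) (cℋ : TemperedPiChart ℋ) (F : Hom 𝒢 ℋ) (φ : c𝒢.G →ₜ* cℋ.G),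
        F.IsLocallyOpen → F.CompatV c𝒢 cℋ φ → F.CompatE c𝒢 cℋ φ → IsCompatiblyQuasiGeometric φ)
    (hR2 : QuasiGeometricGraphDataCompat.{u}) : Cor39CompatUpToTwist.{u} :=
  fun 𝒢 ℋ h𝒢 hℋ c𝒢 cℋ =>
    cor39CompatUpToTwist_of_R0_R2At (hiii ℋ) h𝒢 hℋ c𝒢 cℋ (hR0 𝒢 ℋ h𝒢 hℋ c𝒢 cℋ)
      (hR2 𝒢 ℋ h𝒢 hℋ c𝒢 cℋ)

/-! ### The per-pair closer of record -/

/-- **[SemiAnbd] Corollary 3.9 at the pair `(G, H)` (compatible reading of Def. 3.8, "induced" up to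
the 2-cells of Rmk. 2.4.2), as the body of the named twin `Cor39CompatUpToTwist`, MODULO Theorem 3.7
(iii) AT `G` AND AT `H` ALONE** — the per-pair closer of record (φ2-consumers twin of
`cor39CompatUpToTwist_of_compactInVerticial`, cell ruling α6-1): (a) = R1 ≫ R0′ ((iii) at `𝒢`,
Thm. 3.7 (iv) at `𝒢`, `ℋ`); (b)-existence = R2′ ≫ R3 ((iii) at `𝒢`, `ℋ`); (b)-uniqueness of the whole
underlying morphism of semi-graphs unconditional.  Both inputs are delivered for finite `𝔾` by the
finite-`𝔾` producer (`compactInVerticialAt_of_finiteLevelData`).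
[cite: MochizukiSemiAnbd2006, Cor 3.9 pp.42-43] -/
theorem cor39CompatUpToTwistAt (h𝒢iii : CompactInVerticialAt 𝒢) (hℋiii : CompactInVerticialAt ℋ)
    (h𝒢 : Cor39Hypotheses 𝒢) (hℋ : Cor39Hypotheses ℋ) (c𝒢 : TemperedPiChart 𝒢)
    (cℋ : TemperedPiChart ℋ) :
    (∀ (F : Hom 𝒢 ℋ), F.IsLocallyOpen → ∀ φ : c𝒢.G →ₜ* cℋ.G, F.InducesUpToTwist c𝒢 cℋ φ →
        IsCompatiblyQuasiGeometric φ) ∧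
      ∀ φ : c𝒢.G →ₜ* cℋ.G, IsCompatiblyQuasiGeometric φ →
        ∃ F : Hom 𝒢 ℋ, F.IsLocallyOpen ∧ F.InducesUpToTwist c𝒢 cℋ φ ∧
          ∀ F' : Hom 𝒢 ℋ, F'.IsLocallyOpen → F'.InducesUpToTwist c𝒢 cℋ φ → F'.base = F.base :=
  cor39CompatUpToTwist_of_R0_R2At hℋiii h𝒢 hℋ c𝒢 cℋ
    (fun F φ hF hV hE => isCompatiblyQuasiGeometric_of_compatAt verticialInjective_holds
      verticialDistinct_holds h𝒢iii (maximalCompactIffVerticialAt_of_compactInVerticialAt h𝒢iii)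
      (maximalCompactIffVerticialAt_of_compactInVerticialAt hℋiii) h𝒢 hℋ c𝒢 cℋ F φ hF hV hE)
    (fun φ hφ => quasiGeometricGraphDataCompatAt_of_compactInVerticialAt h𝒢iii hℋiii h𝒢 hℋ c𝒢 cℋ φ hφ)

/-- Sanity link: `Cor39CompatUpToTwist` from Thm. 3.7 (iii) at EVERY graph alone, through the per-pair
closer (agrees with `cor39CompatUpToTwist_of_compactInVerticial` via `compactInVerticial_iff_forall_at`).
[cite: MochizukiSemiAnbd2006, Cor 3.9 pp.42-43] -/
theorem cor39CompatUpToTwist_of_forall_compactInVerticialAt'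
    (h : ∀ 𝒢 : ProfiniteSemiGraph.{u}, CompactInVerticialAt 𝒢) : Cor39CompatUpToTwist.{u} :=
  fun 𝒢 ℋ h𝒢 hℋ c𝒢 cℋ => cor39CompatUpToTwistAt (h 𝒢) (h ℋ) h𝒢 hℋ c𝒢 cℋ

end ProfiniteSemiGraph

end Literature.AnabelianGeometry.SemiGraphs
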